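import Literature.AlgebraicGeometry.HodgeTheory.SmoothSurfaceSecondBettiNumber
import Literature.AlgebraicGeometry.HodgeTheory.BettiNumbersEulerCharacteristic
import Literature.AlgebraicGeometry.HodgeTheory.OddHypersurfaceHodgeConjecture
import HarnessLib

/-!
# The topological Euler characteristic of a smooth surface of degree `d` in `ℙ³` is `d³ − 4d² + 6d` (Eisenbud–Harris 2016, Example 5.24)

Family `hodge`, layer `Literature/AlgebraicGeometry/HodgeTheory`. PROOF FILE (theorems only: no definition, no named fact, no instance;
D-0026 net debt `0`). D. Eisenbud, J. Harris, *3264 and All That* (2016), §5.7 Example 5.24: for a smooth hypersurface `X` of degree `d`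
in `ℙⁿ`, "`χ_top(X) = deg c_{n−1}(T_X) = Σ_{i=0}^{n−1} (−1)^i C(n+1, n−1−i) d^{i+1}`"; for `n = 3`, `χ_top(X) = d³ − 4d² + 6d` (Table 5.1:
cubic `9`, quartic `24`, quintic `55`), "the Betti numbers other than `b_{n−1}` are `1` in even dimensions and `0` in odd". Here, on the
lane's displayed Euler characteristic `Σ_{k ≤ 4} (−1)^k b_k(X(ℂ))` (`BettiUniverse.eulerChar_surface_betti`), from the tree's THEOREMS
`b₂(X_F) = d³ − 4d² + 6d − 2` (`finrank_bettiCohomology_two_hypersurface_of_isNonsingularForm`, Ehresmann + Shioda's count) and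
`b₁(X_F) = b₃(X_F) = 0` (Lefschetz for hypersurfaces, `subsingleton_bettiCohomology_of_odd`), `b₀ = b₄ = 1`.

* `finrank_bettiCohomology_odd_hypersurface_surface` — `b₁(X_F) = b₃(X_F) = 0` for a smooth surface `X_F ⊂ ℙ³`.
* **`eulerChar_hypersurface_surface`** — `Σ_{k ≤ 4} (−1)^k b_k(X_F) = d³ − 4d² + 6d`.
* `bettiNumbers_hypersurface_surface` — the whole list `(b₀, b₁, b₂, b₃, b₄) = (1, 0, d³ − 4d² + 6d − 2, 0, 1)`.

Written by the prover seat `hodge-nonav-prover-Bx` (g10), completing the Eisenbud–Harris citation of `EisenbudHarris2016_surface_secondBettiNumber`.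

## References

* [EisenbudHarris2016] D. Eisenbud, J. Harris, 3264 and All That, CUP 2016, §5.7 Example 5.24 and Table 5.1.
* [VoisinHodgeII2003] C. Voisin, Hodge Theory and Complex Algebraic Geometry II, CUP 2003, §1.2.3 Cor. 1.24–1.25 (Lefschetz for hypersurfaces).
-/

noncomputable section

open CategoryTheory AlgebraicGeometry MvPolynomial Finset

namespace Literature.AlgebraicGeometry.HodgeTheory

open Literature.AlgebraicGeometry.Motives

variable {d : ℕ}

/-- **`b_k(X_F) = 0` for `k` odd** (`k = 1, 3`), `X_F ⊂ ℙ³` a smooth surface cut out by a nonsingular quaternary form `F` of degree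
(Lefschetz below the middle and Poincaré duality above; the tree's `subsingleton_bettiCohomology_of_odd`).
[cite: VoisinHodgeII2003, §1.2.3 Cor. 1.24 and Cor. 1.25] [cite: EisenbudHarris2016, Example 5.24] -/
theorem finrank_bettiCohomology_odd_hypersurface_surface {F : MvPolynomial (Fin (2 + 2)) ℂ}
    (hF : F.IsHomogeneous d) (hX : IsSmoothProjective 2 (SmoothHypersurface.hypersurface F)) {k : ℕ} (hk : Odd k) :
    Module.finrank ℚ (bettiCohomology (SmoothHypersurface.hypersurface F) k) = 0 := by
  have hF0 : F ≠ 0 := ne_zero_of_isSmoothProjective_hypersurface hX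
  have hkn : k ≠ 2 := fun h ↦ by subst h; exact (Nat.not_even_iff_odd.mpr hk) (by decide)
  haveI := subsingleton_bettiCohomology_of_odd hX hF hF0 (SmoothHypersurface.isHypersurfaceCutOutBy_self F) hk hkn
  exact Module.finrank_zero_of_subsingleton

/-- **`χ_top(X_F) = d³ − 4d² + 6d` for a smooth surface `X_F ⊂ ℙ³` of degree `d ≥ 1`** (Eisenbud–Harris Example 5.24 at `n = 3`:
`Σ_{k ≤ 4} (−1)^k b_k = 1 − 0 + (d³ − 4d² + 6d − 2) − 0 + 1`). [cite: EisenbudHarris2016, Example 5.24 and Table 5.1] -/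
theorem eulerChar_hypersurface_surface (hd : 1 ≤ d) {F : MvPolynomial (Fin (2 + 2)) ℂ}
    (hF : F.IsHomogeneous d) (hFns : SmoothHypersurface.IsNonsingularForm ℂ F)
    (hX : IsSmoothProjective 2 (SmoothHypersurface.hypersurface F)) :
    ∑ k ∈ range (2 * 2 + 1), (-1 : ℤ) ^ k * (Module.finrank ℚ (bettiCohomology (SmoothHypersurface.hypersurface F) k) : ℤ) =
      (d : ℤ) ^ 3 - 4 * (d : ℤ) ^ 2 + 6 * d := by
  rw [BettiUniverse.eulerChar_surface_betti hX, finrank_bettiCohomology_odd_hypersurface_surface hF hX odd_one,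
    finrank_bettiCohomology_two_hypersurface_of_isNonsingularForm hd F hF hFns]
  have hle : 4 * d ^ 2 + 2 ≤ d ^ 3 + 6 * d := by
    rcases Nat.lt_or_ge d 4 with h | h
    · interval_cases d <;> norm_num
    · nlinarith
  push_cast [Nat.cast_sub hle]
  ring

set_option maxHeartbeats 400000 in
/-- **The Betti numbers of a smooth surface of degree `d ≥ 1` in `ℙ³`: `(b₀, b₁, b₂, b₃, b₄) = (1, 0, d³ − 4d² + 6d − 2, 0, 1)`**
("the Betti numbers other than `b_{n−1}` are `1` in even dimensions and `0` in odd"). [cite: EisenbudHarris2016, Example 5.24 and Table 5.1] -/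
theorem bettiNumbers_hypersurface_surface (hd : 1 ≤ d) {F : MvPolynomial (Fin (2 + 2)) ℂ}
    (hF : F.IsHomogeneous d) (hFns : SmoothHypersurface.IsNonsingularForm ℂ F)
    (hX : IsSmoothProjective 2 (SmoothHypersurface.hypersurface F)) :
    Module.finrank ℚ (bettiCohomology (SmoothHypersurface.hypersurface F) 0) = 1 ∧
      Module.finrank ℚ (bettiCohomology (SmoothHypersurface.hypersurface F) 1) = 0 ∧
      Module.finrank ℚ (bettiCohomology (SmoothHypersurface.hypersurface F) 2) = d ^ 3 + 6 * d - (4 * d ^ 2 + 2) ∧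
      Module.finrank ℚ (bettiCohomology (SmoothHypersurface.hypersurface F) 3) = 0 ∧
      Module.finrank ℚ (bettiCohomology (SmoothHypersurface.hypersurface F) 4) = 1 :=
  ⟨BettiUniverse.finrank_bettiCohomology_zero hX, finrank_bettiCohomology_odd_hypersurface_surface hF hX odd_one,
    finrank_bettiCohomology_two_hypersurface_of_isNonsingularForm hd F hF hFns,
    finrank_bettiCohomology_odd_hypersurface_surface hF hX (by decide),
    BettiUniverse.finrank_bettiCohomology_top hX⟩

end Literature.AlgebraicGeometry.HodgeTheory

end
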